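import Summits.Ventures.LatticeQCDFlow.Scaling.UnitSurvivalPotential

/-!
HONEST FRAMING: exact (Metropolis-corrected) sampling algorithms for lattice gauge theory; figures
of merit are autocorrelation/cost numbers at stated couplings and volumes; no continuum-physics
claim.

# UnitSurvivalMoments — EXACT ONE-STEP MOMENTS OF THE PLANTED-VALUE COUNT IN THE IDEALISED HOT-ONLY STAR AT UNIFORM
# LISTING: WITH `f` = NUMBER OF COLD LEVELS HOLDING `s`, `g` = 𝟙{THE HUB HOLDS `s`}, `λ = t(1−t)c/m`:
# `P(f + tg) = (f + tg) − λf + t(1−t)ν(s)`, `Pg = (tc/m)f + (1−t)ν(s)`,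
# `P(f + tg)² = t[(f+g)² − 2(1−t)(c/m)(f+g)f + (1−t)²(c/m)f] + (1−t)[f² + 2tν(s)f + t²ν(s)]` (lean-2 GEN-27, ours)

Venture-side (OURS).  Cell `lqcd-flow` (pub-lqcd), unit `pub-lqcd-lean-2-g27`, 2026-08-27.  Chapter M, the floor side,
file 5 — towards the `log K` on the unit-survival floor (`HOME/lean-2/OPEN-MATH-chapterM.md` item 2, second-moment
part).  Setting of `Scaling/UnitSurvivalPotential` with the EXACT hot sampler (`M_0(u,·) = ν`) and UNIFORM listing
(every cold level listed exactly `c` times): idealised hot-only star, identity maps, one law `ν`, hub list `κ`,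
swap fraction `t`.  For a state `s`: `f(z) = #{k : z_{k+1} = s}`, `g(z) = 𝟙{z_0 = s}`, `ι_r(z) = 𝟙{z_{κ_r+1} = s}`
(hypothesis-equations, no definitions).

## What is proved

* §1 bookkeeping: `coldCount_hubSwap` (`f(swap_r z) = f − ι_r + g`), `hubInd_hubSwap` (`g(swap_r z) = ι_r`),
  `coldCount_update_zero`, `hubInd_update_zero`, `sum_entries_coldInd` (`Σ_r ι_r = c·f` at uniform listing),
  `hubInd_sq`, `coldInd_sq`, `coldCount_nonneg`, `coldCount_le`.
* §2 **`ideal_step_potential`** — `Σ_z' P(z,z')(f+tg)(z') = (f+tg)(z) − λ·f(z) + t(1−t)ν(s)`;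
  **`ideal_step_hubInd`** — `Σ_z' P(z,z')g(z') = (tc/m)·f(z) + (1−t)ν(s)`;
  **`ideal_step_potentialSq`** — the displayed second-moment identity.

Reading (no numerics implied): these identities drive the two-moment recursion for `Φ = f + tg`
(`E Φ_{n+1} = (1−λ)EΦ_n + λt·Eg_n + t(1−t)ν(s)`, `E Φ²_{n+1} ≤ (1−2λ)EΦ²_n + O(λ)EΦ_n + O(1)Eg_n + O(ν(s))`) from
which a Paley–Zygmund bound `P(Φ_n > 0) ≥ (EΦ_n)²/EΦ_n²` is to give the floor `t_mix(1/4) ≥ (K/(t(1−t)))·(log K − O(1))`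
(the sequel).  NOT CLAIMED here: anything beyond the one-step identities.  Literature grade (cell rule): OWN
COMPUTATION; nothing cited as a fact; no new bib keys.
-/

noncomputable section

open Finset Function
open Literature.Probability.MarkovChains

namespace Summit.Ventures.LatticeQCDFlow.Scaling

variable {S : Type*} [Fintype S] [DecidableEq S] {K m : ℕ} {ν : S → ℝ} {M : Fin (K + 1) → S → S → ℝ} {t : ℝ}

section Moments
variable (κ : Fin m → Fin K)

/-! ## §1 Bookkeeping for `f`, `g`, `ι_r` -/

omit [Fintype S] in
/-- **`f(swap_r z) = f(z) − ι_r(z) + g(z)`:** the hub swap with entry `r` replaces the content of level `κ_r+1` by the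
hub's. [ours] -/
theorem coldCount_hubSwap (s : S) {f : (Fin (K + 1) → S) → ℝ}
    (hf : ∀ z, f z = ∑ k : Fin K, (if z k.succ = s then (1 : ℝ) else 0))
    {g : (Fin (K + 1) → S) → ℝ} (hg : ∀ z, g z = if z 0 = s then (1 : ℝ) else 0)
    (r : Fin m) (z : Fin (K + 1) → S) :
    f (edgeFlowSwap (Equiv.refl S) 0 (κ r).succ z)
      = f z - (if z (κ r).succ = s then (1 : ℝ) else 0) + g z := by
  obtain ⟨_, hl, hoff⟩ := hubSwap_apply κ r z
  rw [hf, hf, hg, ← Finset.sum_erase_add _ _ (mem_univ (κ r)), ← Finset.sum_erase_add _ _ (mem_univ (κ r)), hl]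
  have hrest : ∑ k ∈ univ.erase (κ r), (if edgeFlowSwap (Equiv.refl S) 0 (κ r).succ z k.succ = s then (1 : ℝ) else 0)
      = ∑ k ∈ univ.erase (κ r), (if z k.succ = s then (1 : ℝ) else 0) :=
    sum_congr rfl fun k hk => by rw [hoff k (Finset.ne_of_mem_erase hk)]
  rw [hrest]
  ring

omit [Fintype S] in
/-- **`g(swap_r z) = ι_r(z)`:** after the swap the hub holds the old content of level `κ_r+1`. [ours] -/
theorem hubInd_hubSwap (s : S) {g : (Fin (K + 1) → S) → ℝ} (hg : ∀ z, g z = if z 0 = s then (1 : ℝ) else 0)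
    (r : Fin m) (z : Fin (K + 1) → S) :
    g (edgeFlowSwap (Equiv.refl S) 0 (κ r).succ z) = if z (κ r).succ = s then (1 : ℝ) else 0 := by
  obtain ⟨h0, _, _⟩ := hubSwap_apply κ r z
  rw [hg, h0]

omit [Fintype S] in
/-- A hot update leaves the cold count unchanged. [ours] -/
theorem coldCount_update_zero (s : S) {f : (Fin (K + 1) → S) → ℝ}
    (hf : ∀ z, f z = ∑ k : Fin K, (if z k.succ = s then (1 : ℝ) else 0)) (z : Fin (K + 1) → S) (v : S) :
    f (update z 0 v) = f z := by
  rw [hf, hf]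
  exact sum_congr rfl fun k _ => by rw [update_of_ne (Fin.succ_ne_zero k)]

omit [Fintype S] in
/-- A hot update sets the hub indicator to `𝟙{v = s}`. [ours] -/
theorem hubInd_update_zero (s : S) {g : (Fin (K + 1) → S) → ℝ} (hg : ∀ z, g z = if z 0 = s then (1 : ℝ) else 0)
    (z : Fin (K + 1) → S) (v : S) : g (update z 0 v) = if v = s then (1 : ℝ) else 0 := by
  rw [hg, update_self]

omit [Fintype S] [DecidableEq S] in
/-- **Uniform listing: `Σ_r ι_r(z) = c·f(z)`** when every cold level is listed exactly `c` times. [ours] -/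
theorem sum_entries_coldInd [DecidableEq S] {c : ℕ} (hcu : ∀ p' : Fin K, (univ.filter (fun r : Fin m => κ r = p')).card = c)
    (s : S) {f : (Fin (K + 1) → S) → ℝ} (hf : ∀ z, f z = ∑ k : Fin K, (if z k.succ = s then (1 : ℝ) else 0))
    (z : Fin (K + 1) → S) :
    ∑ r : Fin m, (if z (κ r).succ = s then (1 : ℝ) else 0) = c * f z := by
  rw [hf, Finset.mul_sum, ← Finset.sum_fiberwise univ κ (fun r : Fin m => if z (κ r).succ = s then (1 : ℝ) else 0)]
  refine sum_congr rfl fun p' _ => ?_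
  rw [sum_congr rfl fun r hr => by rw [(Finset.mem_filter.mp hr).2], sum_const, hcu p', nsmul_eq_mul]

omit [Fintype S] in
/-- `g² = g`. [ours] -/
theorem hubInd_sq (s : S) {g : (Fin (K + 1) → S) → ℝ} (hg : ∀ z, g z = if z 0 = s then (1 : ℝ) else 0)
    (z : Fin (K + 1) → S) : g z * g z = g z := by
  rw [hg]; split_ifs <;> norm_num

omit [Fintype S] [DecidableEq S] in
/-- `ι_r² = ι_r`. [ours] -/
theorem coldInd_sq [DecidableEq S] (s : S) (r : Fin m) (z : Fin (K + 1) → S) :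
    (if z (κ r).succ = s then (1 : ℝ) else 0) * (if z (κ r).succ = s then (1 : ℝ) else 0)
      = if z (κ r).succ = s then (1 : ℝ) else 0 := by
  split_ifs <;> norm_num

omit [Fintype S] in
/-- `0 ≤ f ≤ K`. [ours] -/
theorem coldCount_mem (s : S) {f : (Fin (K + 1) → S) → ℝ}
    (hf : ∀ z, f z = ∑ k : Fin K, (if z k.succ = s then (1 : ℝ) else 0)) (z : Fin (K + 1) → S) :
    0 ≤ f z ∧ f z ≤ K := by
  rw [hf]
  refine ⟨sum_nonneg fun k _ => by split_ifs <;> norm_num, ?_⟩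
  calc ∑ k : Fin K, (if z k.succ = s then (1 : ℝ) else 0) ≤ ∑ _k : Fin K, (1 : ℝ) :=
        sum_le_sum fun k _ => by split_ifs <;> norm_num
    _ = K := by simp

omit [Fintype S] in
/-- `0 ≤ g ≤ 1`. [ours] -/
theorem hubInd_mem (s : S) {g : (Fin (K + 1) → S) → ℝ} (hg : ∀ z, g z = if z 0 = s then (1 : ℝ) else 0)
    (z : Fin (K + 1) → S) : 0 ≤ g z ∧ g z ≤ 1 := by
  rw [hg]; split_ifs <;> norm_num

/-! ## §2 The exact one-step moments -/

/-- **THE FIRST MOMENT: `Σ_z' P(z,z')·(f + tg)(z') = (f + tg)(z) − (t(1−t)c/m)·f(z) + t(1−t)·ν(s)`** for the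
idealised hot-only star at uniform listing with the exact hot sampler (`m ≥ 1`, `ν > 0` of unit mass). [ours] -/
theorem ideal_step_potential (hm : 1 ≤ m) (hν : ∀ v, 0 < ν v) (hν1 : ∑ v, ν v = 1) (hM0 : ∀ u v, M 0 u v = ν v)
    {c : ℕ} (hcu : ∀ p' : Fin K, (univ.filter (fun r : Fin m => κ r = p')).card = c)
    (s : S) {f : (Fin (K + 1) → S) → ℝ} (hf : ∀ z, f z = ∑ k : Fin K, (if z k.succ = s then (1 : ℝ) else 0))
    {g : (Fin (K + 1) → S) → ℝ} (hg : ∀ z, g z = if z 0 = s then (1 : ℝ) else 0) (z : Fin (K + 1) → S) :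
    ∑ z', (t * ptGraphSwap (fun _ : Fin (K + 1) => ν)
          (fun r : Fin m => (((0 : Fin (K + 1)), (κ r).succ) : Fin (K + 1) × Fin (K + 1))) (fun _ => Equiv.refl S) z z'
        + (1 - t) * prodKernel (fun k : Fin (K + 1) => if k = 0 then (1 : ℝ) else 0) M z z') * (f z' + t * g z')
      = (f z + t * g z) - t * (1 - t) * c / m * f z + t * (1 - t) * ν s := by
  have hmpos : (0 : ℝ) < m := Nat.cast_pos.mpr (by omega)
  have hsplit : ∀ z', (t * ptGraphSwap (fun _ : Fin (K + 1) => ν)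
          (fun r : Fin m => (((0 : Fin (K + 1)), (κ r).succ) : Fin (K + 1) × Fin (K + 1))) (fun _ => Equiv.refl S) z z'
        + (1 - t) * prodKernel (fun k : Fin (K + 1) => if k = 0 then (1 : ℝ) else 0) M z z') * (f z' + t * g z')
      = t * (ptGraphSwap (fun _ : Fin (K + 1) => ν)
          (fun r : Fin m => (((0 : Fin (K + 1)), (κ r).succ) : Fin (K + 1) × Fin (K + 1))) (fun _ => Equiv.refl S) z z'
          * (f z' + t * g z'))
        + (1 - t) * (prodKernel (fun k : Fin (K + 1) => if k = 0 then (1 : ℝ) else 0) M z z' * (f z' + t * g z')) :=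
    fun z' => by ring
  simp_rw [hsplit]
  rw [Finset.sum_add_distrib, ← Finset.mul_sum, ← Finset.mul_sum, ideal_swapMean κ hm hν (fun z' => f z' + t * g z') z,
    hotOnly_updateMean (M := M) (fun z' => f z' + t * g z') z]
  -- the swap part
  have hsw : ∑ r : Fin m, (f (edgeFlowSwap (Equiv.refl S) 0 (κ r).succ z) + t * g (edgeFlowSwap (Equiv.refl S) 0 (κ r).succ z))
      = m * (f z + g z) - (1 - t) * (c * f z) := by
    simp_rw [coldCount_hubSwap κ s hf hg, hubInd_hubSwap κ s hg]
    rw [← sum_entries_coldInd κ hcu s hf z]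
    have e : ∀ r : Fin m, f z - (if z (κ r).succ = s then (1 : ℝ) else 0) + g z + t * (if z (κ r).succ = s then (1 : ℝ) else 0)
        = (f z + g z) - (1 - t) * (if z (κ r).succ = s then (1 : ℝ) else 0) := fun r => by ring
    simp_rw [e]
    rw [Finset.sum_sub_distrib, sum_const, card_univ, Fintype.card_fin, nsmul_eq_mul, ← Finset.mul_sum]
  -- the refresh part
  have hup : ∑ v, M 0 (z 0) v * (f (update z 0 v) + t * g (update z 0 v)) = f z + t * ν s := by
    simp_rw [hM0, coldCount_update_zero s hf, hubInd_update_zero s hg]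
    simp_rw [mul_add, Finset.sum_add_distrib, ← Finset.sum_mul, hν1, one_mul]
    congr 1
    simp_rw [mul_ite, mul_one, mul_zero]
    rw [Finset.sum_ite_eq' univ s, if_pos (mem_univ _)]
    ring
  rw [hsw, hup]
  field_simp
  ring

/-- **THE HUB INDICATOR: `Σ_z' P(z,z')·g(z') = (tc/m)·f(z) + (1−t)·ν(s)`.** [ours] -/
theorem ideal_step_hubInd (hm : 1 ≤ m) (hν : ∀ v, 0 < ν v) (hM0 : ∀ u v, M 0 u v = ν v)
    {c : ℕ} (hcu : ∀ p' : Fin K, (univ.filter (fun r : Fin m => κ r = p')).card = c)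
    (s : S) {f : (Fin (K + 1) → S) → ℝ} (hf : ∀ z, f z = ∑ k : Fin K, (if z k.succ = s then (1 : ℝ) else 0))
    {g : (Fin (K + 1) → S) → ℝ} (hg : ∀ z, g z = if z 0 = s then (1 : ℝ) else 0) (z : Fin (K + 1) → S) :
    ∑ z', (t * ptGraphSwap (fun _ : Fin (K + 1) => ν)
          (fun r : Fin m => (((0 : Fin (K + 1)), (κ r).succ) : Fin (K + 1) × Fin (K + 1))) (fun _ => Equiv.refl S) z z'
        + (1 - t) * prodKernel (fun k : Fin (K + 1) => if k = 0 then (1 : ℝ) else 0) M z z') * g z'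
      = t * c / m * f z + (1 - t) * ν s := by
  have hmpos : (0 : ℝ) < m := Nat.cast_pos.mpr (by omega)
  have hsplit : ∀ z', (t * ptGraphSwap (fun _ : Fin (K + 1) => ν)
          (fun r : Fin m => (((0 : Fin (K + 1)), (κ r).succ) : Fin (K + 1) × Fin (K + 1))) (fun _ => Equiv.refl S) z z'
        + (1 - t) * prodKernel (fun k : Fin (K + 1) => if k = 0 then (1 : ℝ) else 0) M z z') * g z'
      = t * (ptGraphSwap (fun _ : Fin (K + 1) => ν)
          (fun r : Fin m => (((0 : Fin (K + 1)), (κ r).succ) : Fin (K + 1) × Fin (K + 1))) (fun _ => Equiv.refl S) z z'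
          * g z')
        + (1 - t) * (prodKernel (fun k : Fin (K + 1) => if k = 0 then (1 : ℝ) else 0) M z z' * g z') :=
    fun z' => by ring
  simp_rw [hsplit]
  rw [Finset.sum_add_distrib, ← Finset.mul_sum, ← Finset.mul_sum, ideal_swapMean κ hm hν g z,
    hotOnly_updateMean (M := M) g z]
  simp_rw [hubInd_hubSwap κ s hg, hM0, hubInd_update_zero s hg]
  rw [sum_entries_coldInd κ hcu s hf z]
  simp_rw [mul_ite, mul_one, mul_zero]
  rw [Finset.sum_ite_eq' univ s, if_pos (mem_univ _)]
  field_simp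

/-- **THE SECOND MOMENT:
`Σ_z' P(z,z')·(f + tg)(z')² = t[(f+g)² − 2(1−t)(c/m)(f+g)f + (1−t)²(c/m)f] + (1−t)[f² + 2tν(s)f + t²ν(s)]`.** [ours] -/
theorem ideal_step_potentialSq (hm : 1 ≤ m) (hν : ∀ v, 0 < ν v) (hν1 : ∑ v, ν v = 1) (hM0 : ∀ u v, M 0 u v = ν v)
    {c : ℕ} (hcu : ∀ p' : Fin K, (univ.filter (fun r : Fin m => κ r = p')).card = c)
    (s : S) {f : (Fin (K + 1) → S) → ℝ} (hf : ∀ z, f z = ∑ k : Fin K, (if z k.succ = s then (1 : ℝ) else 0))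
    {g : (Fin (K + 1) → S) → ℝ} (hg : ∀ z, g z = if z 0 = s then (1 : ℝ) else 0) (z : Fin (K + 1) → S) :
    ∑ z', (t * ptGraphSwap (fun _ : Fin (K + 1) => ν)
          (fun r : Fin m => (((0 : Fin (K + 1)), (κ r).succ) : Fin (K + 1) × Fin (K + 1))) (fun _ => Equiv.refl S) z z'
        + (1 - t) * prodKernel (fun k : Fin (K + 1) => if k = 0 then (1 : ℝ) else 0) M z z') * (f z' + t * g z') ^ 2
      = t * ((f z + g z) ^ 2 - 2 * (1 - t) * (c / m) * (f z + g z) * f z + (1 - t) ^ 2 * (c / m) * f z)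
        + (1 - t) * (f z ^ 2 + 2 * t * ν s * f z + t ^ 2 * ν s) := by
  have hmpos : (0 : ℝ) < m := Nat.cast_pos.mpr (by omega)
  have hsplit : ∀ z', (t * ptGraphSwap (fun _ : Fin (K + 1) => ν)
          (fun r : Fin m => (((0 : Fin (K + 1)), (κ r).succ) : Fin (K + 1) × Fin (K + 1))) (fun _ => Equiv.refl S) z z'
        + (1 - t) * prodKernel (fun k : Fin (K + 1) => if k = 0 then (1 : ℝ) else 0) M z z') * (f z' + t * g z') ^ 2
      = t * (ptGraphSwap (fun _ : Fin (K + 1) => ν)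
          (fun r : Fin m => (((0 : Fin (K + 1)), (κ r).succ) : Fin (K + 1) × Fin (K + 1))) (fun _ => Equiv.refl S) z z'
          * (f z' + t * g z') ^ 2)
        + (1 - t) * (prodKernel (fun k : Fin (K + 1) => if k = 0 then (1 : ℝ) else 0) M z z' * (f z' + t * g z') ^ 2) :=
    fun z' => by ring
  simp_rw [hsplit]
  rw [Finset.sum_add_distrib, ← Finset.mul_sum, ← Finset.mul_sum,
    ideal_swapMean κ hm hν (fun z' => (f z' + t * g z') ^ 2) z, hotOnly_updateMean (M := M) (fun z' => (f z' + t * g z') ^ 2) z]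
  -- the swap part: `Σ_r (f + g − (1−t)ι_r)² = m(f+g)² − 2(1−t)(f+g)·cf + (1−t)²·cf`
  have hA := sum_entries_coldInd κ hcu s hf z
  have hsw : ∑ r : Fin m, (f (edgeFlowSwap (Equiv.refl S) 0 (κ r).succ z) + t * g (edgeFlowSwap (Equiv.refl S) 0 (κ r).succ z)) ^ 2
      = m * (f z + g z) ^ 2 - 2 * (1 - t) * (f z + g z) * (c * f z) + (1 - t) ^ 2 * (c * f z) := by
    simp_rw [coldCount_hubSwap κ s hf hg, hubInd_hubSwap κ s hg]
    have e : ∀ r : Fin m, (f z - (if z (κ r).succ = s then (1 : ℝ) else 0) + g z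
        + t * (if z (κ r).succ = s then (1 : ℝ) else 0)) ^ 2
        = (f z + g z) ^ 2 - 2 * (1 - t) * (f z + g z) * (if z (κ r).succ = s then (1 : ℝ) else 0)
          + (1 - t) ^ 2 * ((if z (κ r).succ = s then (1 : ℝ) else 0) * (if z (κ r).succ = s then (1 : ℝ) else 0)) :=
      fun r => by ring
    simp_rw [e, coldInd_sq κ s]
    rw [Finset.sum_add_distrib, Finset.sum_sub_distrib, sum_const, card_univ, Fintype.card_fin, nsmul_eq_mul,
      ← Finset.mul_sum, ← Finset.mul_sum, hA]
  -- the refresh part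
  have hup : ∑ v, M 0 (z 0) v * (f (update z 0 v) + t * g (update z 0 v)) ^ 2
      = f z ^ 2 + 2 * t * ν s * f z + t ^ 2 * ν s := by
    simp_rw [hM0, coldCount_update_zero s hf, hubInd_update_zero s hg]
    have e : ∀ v, ν v * (f z + t * (if v = s then (1 : ℝ) else 0)) ^ 2
        = ν v * f z ^ 2 + (2 * t * f z + t ^ 2) * (if v = s then ν v else 0) := fun v => by
      split_ifs <;> ring
    simp_rw [e]
    rw [Finset.sum_add_distrib, ← Finset.sum_mul, hν1, one_mul, ← Finset.mul_sum, Finset.sum_ite_eq' univ s,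
      if_pos (mem_univ _)]
    ring
  rw [hsw, hup]
  field_simp

end Moments

end Summit.Ventures.LatticeQCDFlow.Scaling

end
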